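import Summits.QuantumFields.GaugeBoot.TiltedLatticeGauge
import Summits.QuantumFields.GaugeBoot.LatticeWords
import HarnessLib

/-!
# Lattice words and their holonomies on a periodic lattice (gauge-boot, periodic loop equations 1/5)

HONEST FRAMING (cell `pub-gaugeboot`, page 1 of every file): the venture produces certified bounds
on lattice expectations at stated coupling, gauge group, dimension and torus size; NOT a mass gap,
NOT a continuum limit, NOT a string tension; NOT Yang–Mills-summit-bearing (barriers
`FixedCouplingUltralocality`, `PerturbativeInvisibility`).

The tree's loop-equation stack (`LatticeWords.lean` → `WordDerivative.lean` → `PlaquetteInsertion.lean`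
→ `SchwingerDysonPair.lean` → `LoopEquation.lean`) is typed over the cubic torus `Site d L = (ℤ/L)^d`.
The certified-numerics rows on the 45°-tilted periodic box (`TiltedBox.lean`) need the same word
calculus and single-link Schwinger–Dyson identity over the PERIODIC LATTICE `(A, e)` of
`TiltedLatticeGauge.lean` (finite additive site group `A`, marked translations `e : Fin d → A`;
configurations `Config A d G = A × Fin d → G`; Wilson measure `gibbs ρ e β`) — the cell's L1 standard
"the loop equation is a lemma, never silent" (tribunal t1 v2.3, A6(ii)/A13). This is file 1/5 of that
re-typing: the purely algebraic WORD LAYER. The step alphabet `Step d` and the words `Word d`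
(`Word.reverse`, `Word.plaquette`) of `LatticeWords.lean` are reused verbatim; what changes is how a
step acts on sites and which link it reads:

* `Step.move e x s` — the endpoint `x ± e μ` of the step `s = ±μ` taken from `x`; `Step.link e x s` —
  the positively oriented link it traverses (`(x, μ)` resp. `(x - e μ, μ)`);
* `Word.endpoint e x w`, `Word.siteAt e x w k` — endpoint and `k`-th visited site;
* `stepHolonomy e U x s`, `wordHolonomy e U x w` — the ordered product, left to right, of the link
  variables met along the word (`U(x - e μ, μ)⁻¹` for a backward step), in the product order of
  `TiltedRP.holonomy` (`wordHolonomy_plaquette`);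
* the glue: multiplicativity under concatenation, reversal = inverse, backtrack cancellation,
  prefix/suffix factorisation, the one-step formula `stepHolonomy_eq`, `wordHolonomy_congr`.

The cubic torus is the instance `A = Site d L`, `e k = Pi.single k 1` (`Step.move = Step.apply`,
`Step.link = Step.edge` definitionally up to `Site.shift`). Everything is `[folklore]`; no measure theory.

References: K. Wilson, Phys. Rev. D 10 (1974) 2445; V. Kazakov, Z. Zheng, arXiv:2404.16925 §2;
S. Cao, M. Park, S. Sheffield, Comm. AMS 5 (2025),
Thm. 5.7 (`U(N)`) / Thm. 6.104 (`SU(N)`) (arXiv:2307.06790 numbering; informally Thm. 1.14)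
(loop equations on a general finite graph).
-/

namespace Summit.QuantumFields.GaugeBoot

variable {A : Type*} [AddCommGroup A] {d : ℕ}

namespace Step

/-- Endpoint of the step taken from `x` on the periodic lattice `(A, e)`: `x + e μ` forward,
`x - e μ` backward. [folklore] -/
def move (e : Fin d → A) (x : A) : Step d → A
  | fwd μ => x + e μ
  | bwd μ => x - e μ

/-- The positively oriented LINK traversed by the step taken from `x`: `(x, μ)` for `+e_μ`,
`(x - e μ, μ)` for `-e_μ`. [folklore] -/
def link (e : Fin d → A) (x : A) : Step d → TiltedRP.Link A d
  | fwd μ => (x, μ)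
  | bwd μ => (x - e μ, μ)

/-- Unfolding lemma `move_fwd`. [folklore] -/
@[simp] theorem move_fwd (e : Fin d → A) (x : A) (μ : Fin d) : (fwd μ).move e x = x + e μ := rfl
/-- Unfolding lemma `move_bwd`. [folklore] -/
@[simp] theorem move_bwd (e : Fin d → A) (x : A) (μ : Fin d) : (bwd μ).move e x = x - e μ := rfl
/-- Unfolding lemma `link_fwd`. [folklore] -/
@[simp] theorem link_fwd (e : Fin d → A) (x : A) (μ : Fin d) : (fwd μ).link e x = (x, μ) := rfl
/-- Unfolding lemma `link_bwd`. [folklore] -/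
@[simp] theorem link_bwd (e : Fin d → A) (x : A) (μ : Fin d) : (bwd μ).link e x = (x - e μ, μ) := rfl

/-- A step and its reverse cancel on sites. [folklore] -/
@[simp] theorem move_inv_move (e : Fin d → A) (x : A) (s : Step d) : s.inv.move e (s.move e x) = x := by
  cases s <;> simp [Step.move, Step.inv]

/-- The reversed step, taken from the endpoint, traverses the same link. [folklore] -/
@[simp] theorem link_inv_move (e : Fin d → A) (x : A) (s : Step d) :
    s.inv.link e (s.move e x) = s.link e x := by
  cases s <;> simp [Step.move, Step.inv, Step.link]

/-- The axis of the traversed link is the axis of the step. [folklore] -/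
@[simp] theorem link_snd (e : Fin d → A) (x : A) (s : Step d) : (s.link e x).2 = s.axis := by
  cases s <;> rfl

end Step

namespace TiltedRP

namespace Word

/-- Endpoint of the word started at `x`. [folklore] -/
def endpoint (e : Fin d → A) : A → Word d → A
  | x, [] => x
  | x, s :: w => endpoint e (s.move e x) w

/-- The site reached after the first `k` steps of `w` from `x`. [folklore] -/
def siteAt (e : Fin d → A) (x : A) (w : Word d) (k : ℕ) : A := endpoint e x (w.take k)

/-- Unfolding lemma `endpoint_nil`. [folklore] -/
@[simp] theorem endpoint_nil (e : Fin d → A) (x : A) : endpoint e x ([] : Word d) = x := rfl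

/-- Unfolding lemma `endpoint_cons`. [folklore] -/
@[simp] theorem endpoint_cons (e : Fin d → A) (x : A) (s : Step d) (w : Word d) :
    endpoint e x (s :: w) = endpoint e (s.move e x) w := rfl

/-- Endpoint of a concatenation. [folklore] -/
theorem endpoint_append (e : Fin d → A) (x : A) (v w : Word d) :
    endpoint e x (v ++ w) = endpoint e (endpoint e x v) w := by
  induction v generalizing x with
  | nil => rfl
  | cons s v ih => simp [ih]

/-- The reversed word returns to the base point. [folklore] -/
@[simp] theorem endpoint_reverse (e : Fin d → A) (x : A) (w : Word d) :
    endpoint e (endpoint e x w) (Word.reverse w) = x := by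
  induction w generalizing x with
  | nil => rfl
  | cons s w ih => simp [Word.reverse_cons, endpoint_append, ih]

/-- Unfolding lemma `siteAt_zero`. [folklore] -/
@[simp] theorem siteAt_zero (e : Fin d → A) (x : A) (w : Word d) : siteAt e x w 0 = x := rfl

/-- Unfolding lemma `siteAt_succ_cons`. [folklore] -/
@[simp] theorem siteAt_succ_cons (e : Fin d → A) (x : A) (s : Step d) (w : Word d) (k : ℕ) :
    siteAt e x (s :: w) (k + 1) = siteAt e (s.move e x) w k := rfl

/-- The plaquette word is closed. [folklore] -/
@[simp] theorem endpoint_plaquette (e : Fin d → A) (x : A) (i j : Fin d) :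
    endpoint e x (Word.plaquette i j) = x := by
  simp only [Word.plaquette, endpoint_cons, endpoint_nil, Step.move]
  abel

end Word

/-! ### Holonomies -/

section Holonomy

variable {G : Type*} [Group G]

/-- Holonomy of one step from `x`: `U(x, μ)` forward, `U(x - e μ, μ)⁻¹` backward. [folklore] -/
def stepHolonomy (e : Fin d → A) (U : Config A d G) (x : A) : Step d → G
  | .fwd μ => U (x, μ)
  | .bwd μ => (U (x - e μ, μ))⁻¹

/-- Holonomy of a word from `x`: the ordered product, left to right, of the step holonomies (the
product order of `TiltedRP.holonomy`). [folklore] -/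
def wordHolonomy (e : Fin d → A) (U : Config A d G) : A → Word d → G
  | _, [] => 1
  | x, s :: w => stepHolonomy e U x s * wordHolonomy e U (s.move e x) w

/-- Unfolding lemma `stepHolonomy_fwd`. [folklore] -/
@[simp] theorem stepHolonomy_fwd (e : Fin d → A) (U : Config A d G) (x : A) (μ : Fin d) :
    stepHolonomy e U x (.fwd μ) = U (x, μ) := rfl

/-- Unfolding lemma `stepHolonomy_bwd`. [folklore] -/
@[simp] theorem stepHolonomy_bwd (e : Fin d → A) (U : Config A d G) (x : A) (μ : Fin d) :
    stepHolonomy e U x (.bwd μ) = (U (x - e μ, μ))⁻¹ := rfl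

/-- One-step formula through the traversed link: `U_{link}` or `U_{link}⁻¹` by orientation. [folklore] -/
theorem stepHolonomy_eq (e : Fin d → A) (U : Config A d G) (x : A) (s : Step d) :
    stepHolonomy e U x s = if s.isFwd then U (s.link e x) else (U (s.link e x))⁻¹ := by
  cases s <;> rfl

/-- Unfolding lemma `wordHolonomy_nil`. [folklore] -/
@[simp] theorem wordHolonomy_nil (e : Fin d → A) (U : Config A d G) (x : A) :
    wordHolonomy e U x ([] : Word d) = 1 := rfl

/-- Unfolding lemma `wordHolonomy_cons`. [folklore] -/
@[simp] theorem wordHolonomy_cons (e : Fin d → A) (U : Config A d G) (x : A) (s : Step d) (w : Word d) :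
    wordHolonomy e U x (s :: w) = stepHolonomy e U x s * wordHolonomy e U (s.move e x) w := rfl

/-- Holonomy is multiplicative under concatenation. [folklore] -/
theorem wordHolonomy_append (e : Fin d → A) (U : Config A d G) (x : A) (v w : Word d) :
    wordHolonomy e U x (v ++ w) =
      wordHolonomy e U x v * wordHolonomy e U (Word.endpoint e x v) w := by
  induction v generalizing x with
  | nil => simp
  | cons s v ih => simp [ih, mul_assoc]

/-- A word closed at `x` followed by another word: holonomies multiply at `x`. [folklore] -/
theorem wordHolonomy_append_closed (e : Fin d → A) (U : Config A d G) (x : A) (w v : Word d)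
    (hw : Word.endpoint e x w = x) :
    wordHolonomy e U x (w ++ v) = wordHolonomy e U x w * wordHolonomy e U x v := by
  rw [wordHolonomy_append, hw]

/-- Prefix/suffix factorisation at position `k`. [folklore] -/
theorem wordHolonomy_take_drop (e : Fin d → A) (U : Config A d G) (x : A) (w : Word d) (k : ℕ) :
    wordHolonomy e U x (w.take k) * wordHolonomy e U (Word.siteAt e x w k) (w.drop k) =
      wordHolonomy e U x w := by
  rw [Word.siteAt, ← wordHolonomy_append, List.take_append_drop]

/-- The reverse step from the endpoint carries the inverse holonomy. [folklore] -/
@[simp] theorem stepHolonomy_move_inv (e : Fin d → A) (U : Config A d G) (x : A) (s : Step d) :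
    stepHolonomy e U (s.move e x) s.inv = (stepHolonomy e U x s)⁻¹ := by
  cases s <;> simp [Step.move, Step.inv, stepHolonomy]

/-- The reversed word carries the inverse holonomy. [folklore] -/
theorem wordHolonomy_reverse (e : Fin d → A) (U : Config A d G) (x : A) (w : Word d) :
    wordHolonomy e U (Word.endpoint e x w) (Word.reverse w) = (wordHolonomy e U x w)⁻¹ := by
  induction w generalizing x with
  | nil => simp
  | cons s w ih => simp [Word.reverse_cons, wordHolonomy_append, ih, mul_inv_rev]

/-- A word followed by its reverse has trivial holonomy. [folklore] -/
theorem wordHolonomy_append_reverse (e : Fin d → A) (U : Config A d G) (x : A) (w : Word d) :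
    wordHolonomy e U x (w ++ Word.reverse w) = 1 := by
  rw [wordHolonomy_append, wordHolonomy_reverse, mul_inv_cancel]

/-- Backtracks cancel: `v · s · s⁻¹ · w` has the holonomy of `v · w`. [folklore] -/
theorem wordHolonomy_backtrack (e : Fin d → A) (U : Config A d G) (x : A) (v w : Word d) (s : Step d) :
    wordHolonomy e U x (v ++ [s, s.inv] ++ w) = wordHolonomy e U x (v ++ w) := by
  simp [wordHolonomy_append]

/-- The plaquette word `+e_i +e_j −e_i −e_j` has the plaquette holonomy of `TiltedLatticeGauge.lean`
(this pins the orientation convention of `holonomy` in the word calculus). [folklore] -/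
theorem wordHolonomy_plaquette (e : Fin d → A) (U : Config A d G) (x : A) (i j : Fin d) :
    wordHolonomy e U x (Word.plaquette i j) = holonomy e U x i j := by
  have h1 : x + e i + e j - e i = x + e j := by abel
  have h2 : x + e j - e j = x := by abel
  simp [Word.plaquette, stepHolonomy, Step.move, holonomy, h1, h2, mul_assoc]

/-- The holonomy of a word only reads the links it traverses. [folklore] -/
theorem wordHolonomy_congr (e : Fin d → A) {U V : Config A d G} (x : A) (w : Word d)
    (h : ∀ k (hk : k < w.length), U ((w.get ⟨k, hk⟩).link e (Word.siteAt e x w k)) =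
      V ((w.get ⟨k, hk⟩).link e (Word.siteAt e x w k))) :
    wordHolonomy e U x w = wordHolonomy e V x w := by
  induction w generalizing x with
  | nil => simp
  | cons s w ih =>
    simp only [wordHolonomy_cons]
    have h0 := h 0 (by simp)
    simp only [List.get_eq_getElem, List.getElem_cons_zero, Word.siteAt_zero] at h0
    rw [stepHolonomy_eq, stepHolonomy_eq, h0]
    congr 1
    refine ih (s.move e x) fun k hk => ?_
    have := h (k + 1) (by simpa using hk)
    simpa using this

end Holonomy

/-! ### Continuity in the configuration -/

section Continuity

variable {G : Type*} [Group G] [TopologicalSpace G] [IsTopologicalGroup G]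

/-- A step holonomy depends continuously on the configuration. [folklore] -/
theorem continuous_stepHolonomy (e : Fin d → A) (x : A) (s : Step d) :
    Continuous fun U : Config A d G => stepHolonomy e U x s := by
  cases s with
  | fwd μ => exact continuous_apply _
  | bwd μ => exact (continuous_apply _).inv

/-- A word holonomy depends continuously on the configuration. [folklore] -/
theorem continuous_wordHolonomy (e : Fin d → A) : ∀ (x : A) (w : Word d),
    Continuous fun U : Config A d G => wordHolonomy e U x w
  | x, [] => by simpa using continuous_const
  | x, s :: w => by
    simp only [wordHolonomy_cons]
    exact (continuous_stepHolonomy e x s).mul (continuous_wordHolonomy e (s.move e x) w)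

end Continuity

end TiltedRP

end Summit.QuantumFields.GaugeBoot
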